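import Literature.Computability.QuantumComplexity.RevGadgets
import HarnessLib

/-!
# Reversible arithmetic gadgets, I: register values and the out-of-place ripple-carry adder

Topic `Literature/Computability/QuantumComplexity`; infrastructure for the discharge of
`ajl_jonesApproxProblem_mem_PromiseBQP` (`JonesInBQP.lean`). The block encodings of the irrational
gates of the Aharonov–Jones–Landau algorithm (`HadamardSandwich.lean`) phase the uniform
superposition of a register `a` by a sign `(-1)^{[P(a)]}` where `P` is an *integer polynomial
inequality* in the value of `a` (e.g. `5·16^k < (2(2^k − 2a)² + 4^k)²`, which cuts the dyadic
interval at `1/2 − 1/(2√φ)`). The predicate is computed — with garbage, to be uncomputed after the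
phase — by the classical reversible gadgets of this file and its sequels, written in the
proof-free `NOT`/`CNOT`/Toffoli layer `ClOp` of `RevGadgets.lean` over *structured wire types*
(transport to the wires of a circuit by `ClOp.map`, `clEval_map_apply`). Every gadget writes only
into fresh (zero) wires, so that its semantics is a plain evaluation (Arora–Barak 2009, proof of
Lemma 10.10; Nielsen–Chuang 2010, §3.2.5; the ripple-carry adder: Vedral–Barenco–Ekert 1996, §3.1 "plain adder", arXiv numbering).

* `regVal r w` — the little-endian value of a register `r : Fin m → ι` (Batteries' `Nat.ofBits` of its
  bits; `regVal_eq_sum`, `regVal_congr`, `regVal_lt`, `testBit_regVal`, `regVal_eq_of_testBit`);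
* `maj`, `carryFn`, **`sum_add_carry`** — the carry recursion of binary addition and the identity
  `Σ_{j<m} (a_j ⊕ b_j ⊕ c_j) 2^j + c_m 2^m = A + B + c_0`;
* layers `notOps` / `copyRegOps` (`clEval_notOps`, `clEval_copyOps`, `regVal_not`);
* the **out-of-place ripple-carry adder** over the wire type `AddW m` (inputs `a, b : Fin m`, sums
  `s : Fin m`, carries `c : Fin (m+1)`, `c 0` = carry-in): `addStage`, `addPrefix`, `addOps`;
  `clEval_addPrefix` (the state after `i` stages), **`clEval_addOps`** and **`regVal_addOps`**:
  on an assignment whose sum and carry wires (beyond `c 0`) are clear, the program leaves `a`, `b`,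
  `c 0` unchanged, writes the sum bits and carries, and `value(s) + 2^m · c_m = value(a) +
  value(b) + c_0`;
* the **comparator** `ltOps` (`¬` on `b`, add, `¬` on `b`): `clEval_ltOps_apply` — inputs restored and
  the carry-out reads `[value(b) < value(a)]`.

## References

* V. Vedral, A. Barenco, A. Ekert, *Quantum networks for elementary arithmetic operations*,
  Phys. Rev. A 54 (1996) 147–153, §3.1 (plain adder from carry and sum gates) [VedralBarencoEkert1996].
* S. Arora, B. Barak, *Computational Complexity: A Modern Approach*, CUP 2009, §10.3.7,
  Lemma 10.10 [AroraBarakCC2009].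
* M. A. Nielsen, I. L. Chuang, *Quantum Computation and Quantum Information*, CUP 2010, §3.2.5
  [NielsenChuang2010].
-/

namespace Literature.Computability.QuantumComplexity

open Function

/-! ### Register values -/

section RegVal

variable {ι : Type*} {m : ℕ}

/-- The little-endian value of the register `r` under the assignment `w`: Batteries' `Nat.ofBits` of
its bits (so that `Nat.testBit_ofBits`, `Nat.ofBits_lt_two_pow`, `Nat.ofBits_testBit` apply). [folklore] -/
def regVal (r : Fin m → ι) (w : ι → Bool) : ℕ := Nat.ofBits fun j => w (r j)

/-- `Nat.ofBits` as the weighted sum of the bits. [folklore] -/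
theorem ofBits_eq_sum : ∀ {m : ℕ} (f : Fin m → Bool), Nat.ofBits f = ∑ j : Fin m, (f j).toNat * 2 ^ (j : ℕ)
  | 0, f => by simp
  | m + 1, f => by
    rw [Nat.ofBits_succ, ofBits_eq_sum (f ∘ Fin.succ), Fin.sum_univ_succ, Finset.mul_sum]
    simp only [Function.comp_apply, Fin.val_zero, pow_zero, mul_one, Fin.val_succ, pow_succ]
    rw [add_comm]
    congr 1
    exact Finset.sum_congr rfl fun j _ => by ring

/-- **The value as a weighted sum** `Σ_j w(r j)·2^j` (bridge to the arithmetic below). [folklore] -/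
theorem regVal_eq_sum (r : Fin m → ι) (w : ι → Bool) : regVal r w = ∑ j : Fin m, (w (r j)).toNat * 2 ^ (j : ℕ) :=
  ofBits_eq_sum _

/-- Registers read through equal bits have equal values. [folklore] -/
theorem regVal_congr {r r' : Fin m → ι} {w w' : ι → Bool} (h : ∀ j, w (r j) = w' (r' j)) :
    regVal r w = regVal r' w' := by
  unfold regVal; exact congrArg Nat.ofBits (funext h)

/-- Register values are below `2^m`. [folklore] -/
theorem regVal_lt (r : Fin m → ι) (w : ι → Bool) : regVal r w < 2 ^ m := Nat.ofBits_lt_two_pow _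

/-- The bits of a register are the bits of its value. [folklore] -/
theorem testBit_regVal (r : Fin m → ι) (w : ι → Bool) (j : Fin m) : (regVal r w).testBit j = w (r j) := by
  rw [regVal, Nat.testBit_ofBits_lt _ _ j.2]

/-- A register whose bits are the bits of `v < 2^m` has value `v`. [folklore] -/
theorem regVal_eq_of_testBit (r : Fin m → ι) (w : ι → Bool) {v : ℕ} (hv : v < 2 ^ m) (h : ∀ j : Fin m, w (r j) = v.testBit j) :
    regVal r w = v := by
  rw [regVal, show (fun j : Fin m => w (r j)) = fun j : Fin m => v.testBit j from funext h, Nat.ofBits_testBit, Nat.mod_eq_of_lt hv]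

end RegVal

/-! ### The carry recursion -/

section Carry

/-- Majority of three bits, written `ab ⊕ ac ⊕ bc` as the three-Toffoli carry stage computes it
(equal to core's `Bool.atLeastTwo`, `maj_eq_atLeastTwo`). [cite: VedralBarencoEkert1996, §3.1 (carry gate)] -/
def maj (x y z : Bool) : Bool := ((x && y) ^^ (x && z)) ^^ (y && z)

/-- `maj` is core's `Bool.atLeastTwo` (so the `BitVec.adc` lemmas are reachable). [folklore] -/
theorem maj_eq_atLeastTwo (x y z : Bool) : maj x y z = Bool.atLeastTwo x y z := by
  cases x <;> cases y <;> cases z <;> rfl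

/-- The carries of the addition of the bit streams `av`, `bv` with carry-in `c₀`.
[cite: VedralBarencoEkert1996, §3.1] -/
def carryFn (av bv : ℕ → Bool) (c₀ : Bool) : ℕ → Bool
  | 0 => c₀
  | j + 1 => maj (av j) (bv j) (carryFn av bv c₀ j)

/-- One column of binary addition: `a + b + c = (a ⊕ b ⊕ c) + 2·maj(a,b,c)`. [folklore] -/
theorem toNat_add_toNat_add_toNat (x y z : Bool) :
    x.toNat + y.toNat + z.toNat = ((x ^^ y) ^^ z).toNat + 2 * (maj x y z).toNat := by
  cases x <;> cases y <;> cases z <;> rfl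

/-- **Ripple-carry addition is correct**: `Σ_{j<m} (a_j ⊕ b_j ⊕ c_j) 2^j + c_m 2^m =
Σ_{j<m} a_j 2^j + Σ_{j<m} b_j 2^j + c_0`. [cite: VedralBarencoEkert1996, §3.1] -/
theorem sum_add_carry (av bv : ℕ → Bool) (c₀ : Bool) (m : ℕ) :
    (∑ j ∈ Finset.range m, (((av j ^^ bv j) ^^ carryFn av bv c₀ j).toNat * 2 ^ j)) +
        (carryFn av bv c₀ m).toNat * 2 ^ m =
      (∑ j ∈ Finset.range m, (av j).toNat * 2 ^ j) + (∑ j ∈ Finset.range m, (bv j).toNat * 2 ^ j) + c₀.toNat := by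
  induction m with
  | zero => simp [carryFn]
  | succ m ih =>
    rw [Finset.sum_range_succ, Finset.sum_range_succ, Finset.sum_range_succ, pow_succ]
    have hcol := toNat_add_toNat_add_toNat (av m) (bv m) (carryFn av bv c₀ m)
    have e : carryFn av bv c₀ (m + 1) = maj (av m) (bv m) (carryFn av bv c₀ m) := rfl
    rw [e]
    set S := ∑ x ∈ Finset.range m, ((av x ^^ bv x) ^^ carryFn av bv c₀ x).toNat * 2 ^ x
    set A := ∑ x ∈ Finset.range m, (av x).toNat * 2 ^ x
    set B := ∑ x ∈ Finset.range m, (bv x).toNat * 2 ^ x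
    calc S + ((av m ^^ bv m) ^^ carryFn av bv c₀ m).toNat * 2 ^ m +
          (maj (av m) (bv m) (carryFn av bv c₀ m)).toNat * (2 ^ m * 2)
        = S + ((((av m ^^ bv m) ^^ carryFn av bv c₀ m).toNat + 2 * (maj (av m) (bv m) (carryFn av bv c₀ m)).toNat) * 2 ^ m) := by
          ring
      _ = S + ((av m).toNat + (bv m).toNat + (carryFn av bv c₀ m).toNat) * 2 ^ m := by rw [hcol]
      _ = (S + (carryFn av bv c₀ m).toNat * 2 ^ m) + (av m).toNat * 2 ^ m + (bv m).toNat * 2 ^ m := by ring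
      _ = (A + B + c₀.toNat) + (av m).toNat * 2 ^ m + (bv m).toNat * 2 ^ m := by rw [ih]
      _ = A + (av m).toNat * 2 ^ m + (B + (bv m).toNat * 2 ^ m) + c₀.toNat := by ring

end Carry

/-! ### The out-of-place ripple-carry adder -/

section Adder

/-- The wires of the adder of width `m`: inputs `a`, `b`, sum bits `s`, carries `c` (`c 0` is the
carry-in, `c m` the carry-out). [cite: VedralBarencoEkert1996, §3.1] -/
inductive AddW (m : ℕ)
  /-- input bit `a_j` -/
  | a (j : Fin m)
  /-- input bit `b_j` -/
  | b (j : Fin m)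
  /-- sum bit `s_j` -/
  | s (j : Fin m)
  /-- carry `c_j` -/
  | c (j : Fin (m + 1))
  deriving DecidableEq

variable {m : ℕ}

/-- Stage `i` of the adder: `c_{i+1} ⊕= maj(a_i, b_i, c_i)` (three Toffolis) and
`s_i ⊕= a_i ⊕ b_i ⊕ c_i` (three `CNOT`s), all into fresh wires. [cite: VedralBarencoEkert1996, §3.1] -/
def addStage (i : Fin m) : List (ClOp (AddW m)) :=
  [ClOp.toffoli (AddW.a i) (AddW.b i) (AddW.c i.succ), ClOp.toffoli (AddW.a i) (AddW.c i.castSucc) (AddW.c i.succ),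
    ClOp.toffoli (AddW.b i) (AddW.c i.castSucc) (AddW.c i.succ),
    ClOp.cnot (AddW.a i) (AddW.s i), ClOp.cnot (AddW.b i) (AddW.s i), ClOp.cnot (AddW.c i.castSucc) (AddW.s i)]

/-- Every operation of a stage is well formed (its wires are distinct). [folklore] -/
theorem addStage_wf (i : Fin m) : ∀ op ∈ addStage i, op.WF := by
  intro op hop
  simp only [addStage, List.mem_cons, List.not_mem_nil, or_false] at hop
  rcases hop with rfl | rfl | rfl | rfl | rfl | rfl <;> simp [ClOp.WF, Fin.ext_iff]

/-- The first `i` stages of the adder. [folklore] -/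
def addPrefix : ℕ → List (ClOp (AddW m))
  | 0 => []
  | i + 1 => addPrefix i ++ (if h : i < m then addStage ⟨i, h⟩ else [])

/-- **The adder**: all `m` stages. [cite: VedralBarencoEkert1996, §3.1] -/
def addOps (m : ℕ) : List (ClOp (AddW m)) := addPrefix m

/-- Every operation of the first `i` stages is well formed. [folklore] -/
theorem addPrefix_wf : ∀ (i : ℕ), ∀ op ∈ (addPrefix i : List (ClOp (AddW m))), op.WF
  | 0, op, hop => by simp [addPrefix] at hop
  | i + 1, op, hop => by
    rw [addPrefix, List.mem_append] at hop
    rcases hop with hop | hop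
    · exact addPrefix_wf i op hop
    · split_ifs at hop with h
      · exact addStage_wf ⟨i, h⟩ op hop
      · simp at hop

/-- **Every operation of the adder is well formed** (needed by the `ClOp.toRev` bridge). [folklore] -/
theorem addOps_wf : ∀ op ∈ addOps m, op.WF := addPrefix_wf m

/-- The input bit streams of an assignment of the adder wires. [folklore] -/
def AddW.inA (w : AddW m → Bool) (j : ℕ) : Bool := if h : j < m then w (AddW.a ⟨j, h⟩) else false

/-- The second input bit stream. [folklore] -/
def AddW.inB (w : AddW m → Bool) (j : ℕ) : Bool := if h : j < m then w (AddW.b ⟨j, h⟩) else false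

/-- The carries of the addition encoded by `w`. [folklore] -/
def AddW.carry (w : AddW m → Bool) (j : ℕ) : Bool := carryFn (AddW.inA w) (AddW.inB w) (w (AddW.c 0)) j

/-- **The state after `i` stages**: inputs and carry-in unchanged, sum bits and carries written
below `i`, untouched (hence as initially) from `i` on. [folklore] -/
def addState (i : ℕ) (w : AddW m → Bool) : AddW m → Bool
  | AddW.a j => w (AddW.a j)
  | AddW.b j => w (AddW.b j)
  | AddW.s j => if (j : ℕ) < i then (w (AddW.a j) ^^ w (AddW.b j)) ^^ AddW.carry w j else w (AddW.s j)
  | AddW.c j => if (j : ℕ) ≤ i then AddW.carry w j else w (AddW.c j)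

/-- Initially the state is the assignment itself. [folklore] -/
theorem addState_zero (w : AddW m → Bool) : addState 0 w = w := by
  funext x
  cases x with
  | a j => rfl
  | b j => rfl
  | s j => simp [addState]
  | c j =>
    simp only [addState]
    by_cases hj : (j : ℕ) ≤ 0
    · have : j = 0 := Fin.ext (by simpa using hj)
      subst this
      simp [AddW.carry, carryFn]
    · rw [if_neg hj]

/-- One stage advances the state. [cite: VedralBarencoEkert1996, §3.1] -/
theorem clEval_addStage_addState (i : Fin m) (w : AddW m → Bool) (hs : ∀ j, w (AddW.s j) = false)
    (hc : ∀ j : Fin (m + 1), j ≠ 0 → w (AddW.c j) = false) :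
    clEval (addStage i) (addState i w) = addState (i + 1) w := by
  have hdis : ∀ op ∈ addStage i, ∀ op' ∈ addStage i, op'.target ∉ op.controls := by
    intro op hop op' hop'
    simp only [addStage, List.mem_cons, List.not_mem_nil, or_false] at hop hop'
    rcases hop with rfl | rfl | rfl | rfl | rfl | rfl <;> rcases hop' with rfl | rfl | rfl | rfl | rfl | rfl <;>
      simp [ClOp.target, ClOp.controls, Fin.ext_iff]
  -- values of the controls in the current state
  have va : addState i w (AddW.a i) = w (AddW.a i) := rfl
  have vb : addState i w (AddW.b i) = w (AddW.b i) := rfl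
  have vc : addState i w (AddW.c i.castSucc) = AddW.carry w i := by simp [addState]
  -- the toggle of every wire
  have tog : ∀ x, clToggle (addStage i) (addState i w) x =
      ((decide (x = AddW.c i.succ) && maj (w (AddW.a i)) (w (AddW.b i)) (AddW.carry w i)) ^^
        (decide (x = AddW.s i) && ((w (AddW.a i) ^^ w (AddW.b i)) ^^ AddW.carry w i))) := by
    intro x
    simp only [addStage, clToggle_cons, clToggle_nil, ClOp.target, ClOp.guard, va, vb, vc, maj]
    by_cases h1 : x = AddW.c i.succ
    · subst h1
      simp only [decide_true, Bool.true_and, reduceCtorEq, decide_false, Bool.false_and, Bool.xor_false]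
      cases w (AddW.a i) <;> cases w (AddW.b i) <;> cases AddW.carry w i <;> rfl
    · by_cases h2 : x = AddW.s i
      · subst h2
        simp only [decide_true, Bool.true_and, reduceCtorEq, decide_false, Bool.false_and, Bool.xor_false, Bool.false_xor]
        cases w (AddW.a i) <;> cases w (AddW.b i) <;> cases AddW.carry w i <;> rfl
      · have h1' : (AddW.c i.succ = x) ↔ False := ⟨fun e => h1 e.symm, False.elim⟩
        have h2' : (AddW.s i = x) ↔ False := ⟨fun e => h2 e.symm, False.elim⟩
        simp [h1, h2, h1', h2']
  funext x
  rw [clEval_apply_of_disjoint _ hdis, tog]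
  cases x with
  | a j => simp [addState]
  | b j => simp [addState]
  | s j =>
    by_cases hji : j = i
    · subst hji
      simp [addState, hs j]
    · have h1 : ((j : ℕ) < i + 1) ↔ ((j : ℕ) < i) := by
        constructor
        · intro h; exact lt_of_le_of_ne (Nat.lt_succ_iff.1 h) (fun e => hji (Fin.ext e))
        · omega
      simp [addState, hji, h1]
  | c j =>
    by_cases hji : j = i.succ
    · subst hji
      have e1 : ¬ ((i : ℕ) + 1 ≤ i) := Nat.not_succ_le_self _
      simp [addState, hc i.succ (Fin.succ_ne_zero i), Fin.val_succ, e1, AddW.carry, carryFn, AddW.inA, AddW.inB, i.2, maj]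
    · have h1 : ((j : ℕ) ≤ i + 1) ↔ ((j : ℕ) ≤ i) := by
        constructor
        · intro h
          rcases Nat.lt_or_ge (j : ℕ) (i + 1) with h' | h'
          · omega
          · exact absurd (Fin.ext (by simp; omega)) hji
        · omega
      simp [addState, hji, h1]

/-- **The state after the first `i` stages** (`i ≤ m`). [cite: VedralBarencoEkert1996, §3.1] -/
theorem clEval_addPrefix (w : AddW m → Bool) (hs : ∀ j, w (AddW.s j) = false)
    (hc : ∀ j : Fin (m + 1), j ≠ 0 → w (AddW.c j) = false) :
    ∀ i ≤ m, clEval (addPrefix i) w = addState i w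
  | 0, _ => by rw [addPrefix, clEval_nil, addState_zero w]
  | i + 1, hi => by
    rw [addPrefix, clEval_append, clEval_addPrefix w hs hc i (by omega), dif_pos (show i < m by omega)]
    exact clEval_addStage_addState ⟨i, by omega⟩ w hs hc

/-- **Semantics of the adder**: inputs and carry-in unchanged, `s_j = a_j ⊕ b_j ⊕ c_j`, `c_j` = the
`j`-th carry. [cite: VedralBarencoEkert1996, §3.1] -/
theorem clEval_addOps (w : AddW m → Bool) (hs : ∀ j, w (AddW.s j) = false)
    (hc : ∀ j : Fin (m + 1), j ≠ 0 → w (AddW.c j) = false) (x : AddW m) :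
    clEval (addOps m) w x = match x with
      | AddW.a j => w (AddW.a j)
      | AddW.b j => w (AddW.b j)
      | AddW.s j => (w (AddW.a j) ^^ w (AddW.b j)) ^^ AddW.carry w j
      | AddW.c j => AddW.carry w j := by
  rw [addOps, clEval_addPrefix w hs hc m le_rfl]
  cases x with
  | a j => rfl
  | b j => rfl
  | s j => simp [addState]
  | c j => simp [addState, Nat.lt_succ_iff.1 j.2]

/-- **The adder adds**: `value(s) + 2^m · c_m = value(a) + value(b) + c_0`.
[cite: VedralBarencoEkert1996, §3.1] -/
theorem regVal_addOps (w : AddW m → Bool) (hs : ∀ j, w (AddW.s j) = false)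
    (hc : ∀ j : Fin (m + 1), j ≠ 0 → w (AddW.c j) = false) :
    regVal AddW.s (clEval (addOps m) w) + (clEval (addOps m) w (AddW.c (Fin.last m))).toNat * 2 ^ m =
      regVal AddW.a w + regVal AddW.b w + (w (AddW.c 0)).toNat := by
  have key := sum_add_carry (AddW.inA w) (AddW.inB w) (w (AddW.c 0)) m
  have eS : regVal AddW.s (clEval (addOps m) w) =
      ∑ j ∈ Finset.range m, (((AddW.inA w j ^^ AddW.inB w j) ^^ carryFn (AddW.inA w) (AddW.inB w) (w (AddW.c 0)) j).toNat * 2 ^ j) := by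
    rw [regVal_eq_sum, ← Fin.sum_univ_eq_sum_range]
    refine Finset.sum_congr rfl fun j _ => ?_
    rw [clEval_addOps w hs hc]
    simp only [AddW.inA, AddW.inB, dif_pos j.2, AddW.carry]
  have eA : regVal AddW.a w = ∑ j ∈ Finset.range m, (AddW.inA w j).toNat * 2 ^ j := by
    rw [regVal_eq_sum, ← Fin.sum_univ_eq_sum_range]
    refine Finset.sum_congr rfl fun j _ => ?_
    simp only [AddW.inA, dif_pos j.2]
  have eB : regVal AddW.b w = ∑ j ∈ Finset.range m, (AddW.inB w j).toNat * 2 ^ j := by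
    rw [regVal_eq_sum, ← Fin.sum_univ_eq_sum_range]
    refine Finset.sum_congr rfl fun j _ => ?_
    simp only [AddW.inB, dif_pos j.2]
  have eC : clEval (addOps m) w (AddW.c (Fin.last m)) = carryFn (AddW.inA w) (AddW.inB w) (w (AddW.c 0)) m := by
    rw [clEval_addOps w hs hc]; simp [AddW.carry]
  rw [eS, eA, eB, eC, key]

end Adder

/-! ### Layers of `NOT`s and of `CNOT` copies -/

section Layers

variable {ι : Type*} [DecidableEq ι] {m : ℕ}

/-- `NOT` on every wire of a register. [folklore] -/
def notOps (r : Fin m → ι) : List (ClOp ι) := (List.finRange m).map fun j => ClOp.not (r j)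

omit [DecidableEq ι] in
/-- `notOps` is the `NOT` layer of the list of its wires. [folklore] -/
theorem notOps_eq_map (r : Fin m → ι) : notOps r = ((List.finRange m).map r).map ClOp.not := by
  simp [notOps]

/-- **A layer of `NOT`s complements its register and changes nothing else** (from
`clEval_map_not_of_mem` / `clEval_map_not_of_not_mem` of `RevGadgets.lean`). [folklore] -/
theorem clEval_notOps (r : Fin m → ι) (hr : Function.Injective r) (w : ι → Bool) (x : ι) :
    clEval (notOps r) w x = if x ∈ Set.range r then !w x else w x := by
  rw [notOps_eq_map]
  by_cases hx : x ∈ Set.range r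
  · obtain ⟨j, rfl⟩ := hx
    rw [if_pos ⟨j, rfl⟩]
    exact clEval_map_not_of_mem _ ((List.nodup_finRange m).map hr) w (List.mem_map.2 ⟨j, List.mem_finRange j, rfl⟩)
  · rw [if_neg hx]
    exact clEval_map_not_of_not_mem _ w fun h => hx (by
      obtain ⟨j, -, rfl⟩ := List.mem_map.1 h; exact ⟨j, rfl⟩)

omit [DecidableEq ι] in
/-- Every operation of a `NOT` layer is well formed. [folklore] -/
theorem notOps_wf (r : Fin m → ι) : ∀ op ∈ notOps r, op.WF := by
  intro op hop
  simp only [notOps, List.mem_map] at hop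
  obtain ⟨j, -, rfl⟩ := hop
  trivial

/-- Copying a register onto fresh wires by `CNOT`s (register form of the fan-out layer `copyOps` of
`RevUncompute.lean`). [folklore] -/
def copyRegOps (src dst : Fin m → ι) : List (ClOp ι) := (List.finRange m).map fun j => ClOp.cnot (src j) (dst j)

/-- **A copy layer XORs the source into each destination wire** (so copies it when the destination is
clear), provided no destination wire is a source wire. [folklore] -/
theorem clEval_copyRegOps_dst (src dst : Fin m → ι) (hdst : Function.Injective dst) (hdis : ∀ i j, dst i ≠ src j)
    (w : ι → Bool) (j : Fin m) :
    clEval (copyRegOps src dst) w (dst j) = (w (dst j) ^^ w (src j)) := by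
  have hdis' : ∀ op ∈ copyRegOps src dst, ∀ op' ∈ copyRegOps src dst, op'.target ∉ op.controls := by
    intro op hop op' hop'
    simp only [copyRegOps, List.mem_map] at hop hop'
    obtain ⟨i, -, rfl⟩ := hop
    obtain ⟨i', -, rfl⟩ := hop'
    simp [ClOp.controls, ClOp.target, hdis]
  have hnd : ((copyRegOps src dst).map ClOp.target).Nodup := by
    rw [copyRegOps, List.map_map]
    exact (List.nodup_finRange m).map (fun a b h => hdst (by simpa [ClOp.target] using h))
  have := clEval_apply_target_of_nodup (copyRegOps src dst) hdis' hnd w (op := ClOp.cnot (src j) (dst j))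
    (by simp only [copyRegOps, List.mem_map, List.mem_finRange, true_and]; exact ⟨j, rfl⟩)
  simpa [ClOp.target, ClOp.guard] using this

/-- A copy layer does not change wires that are not destinations. [folklore] -/
theorem clEval_copyRegOps_of_not_mem (src dst : Fin m → ι) (w : ι → Bool) {x : ι} (hx : x ∉ Set.range dst) :
    clEval (copyRegOps src dst) w x = w x :=
  clEval_apply_of_forall_target_ne _ _ fun op hop => by
    simp only [copyRegOps, List.mem_map] at hop
    obtain ⟨j, -, rfl⟩ := hop
    exact fun e => hx ⟨j, e⟩

omit [DecidableEq ι] in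
/-- Every operation of a copy layer is well formed when no destination is a source. [folklore] -/
theorem copyRegOps_wf (src dst : Fin m → ι) (hdis : ∀ i j, dst i ≠ src j) : ∀ op ∈ copyRegOps src dst, op.WF := by
  intro op hop
  simp only [copyRegOps, List.mem_map] at hop
  obtain ⟨j, -, rfl⟩ := hop
  exact (hdis j j).symm

omit [DecidableEq ι] in
/-- The value of a complemented register. [folklore] -/
theorem regVal_not (r : Fin m → ι) (w w' : ι → Bool) (h : ∀ j, w' (r j) = !w (r j)) :
    regVal r w' + regVal r w = 2 ^ m - 1 := by
  have key : ∀ f : Fin m → Bool, (∑ j : Fin m, (!f j).toNat * 2 ^ (j : ℕ)) + (∑ j : Fin m, (f j).toNat * 2 ^ (j : ℕ)) = 2 ^ m - 1 := by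
    intro f
    rw [← Finset.sum_add_distrib]
    have e : ∀ j : Fin m, (!f j).toNat * 2 ^ (j : ℕ) + (f j).toNat * 2 ^ (j : ℕ) = 2 ^ (j : ℕ) := by
      intro j; cases f j <;> simp
    simp_rw [e]
    rw [Fin.sum_univ_eq_sum_range (fun j => 2 ^ j) m]
    have := Nat.geomSum_eq le_rfl m
    simpa using this
  have e1 : regVal r w' = ∑ j : Fin m, (!w (r j)).toNat * 2 ^ (j : ℕ) := by
    rw [regVal_eq_sum]; exact Finset.sum_congr rfl fun j _ => by rw [h j]
  rw [e1, regVal_eq_sum]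
  exact key fun j => w (r j)

end Layers

/-! ### The comparator `[u < v]` as the carry-out of `v + ¬u` -/

section Compare

variable {m : ℕ}

/-- **The comparator program** on the adder wires: with `u` on the `b`-wires and `v` on the
`a`-wires (carry-in clear), complement `u`, add, restore `u`; the carry-out `c_m` then reads
`[u < v]` since `v + (2^m − 1 − u) ≥ 2^m ↔ u < v` (cf. Vedral–Barenco–Ekert, who compare through
the overflow bit of the reversed adder instead). [folklore] -/
def ltOps (m : ℕ) : List (ClOp (AddW m)) := notOps AddW.b ++ addOps m ++ notOps AddW.b

/-- Every operation of the comparator is well formed. [folklore] -/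
theorem ltOps_wf : ∀ op ∈ ltOps m, op.WF := by
  intro op hop
  rw [ltOps, List.mem_append, List.mem_append] at hop
  rcases hop with (hop | hop) | hop
  · exact notOps_wf _ op hop
  · exact addOps_wf op hop
  · exact notOps_wf _ op hop

/-- **Semantics of the comparator**: inputs restored, carry-out `= [value(b) < value(a)]`. [folklore] -/
theorem clEval_ltOps_apply (w : AddW m → Bool) (hs : ∀ j, w (AddW.s j) = false) (hc : ∀ j : Fin (m + 1), w (AddW.c j) = false) :
    clEval (ltOps m) w (AddW.c (Fin.last m)) = decide (regVal AddW.b w < regVal AddW.a w) ∧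
      (∀ j, clEval (ltOps m) w (AddW.a j) = w (AddW.a j)) ∧ (∀ j, clEval (ltOps m) w (AddW.b j) = w (AddW.b j)) := by
  have hinj : Function.Injective (AddW.b : Fin m → AddW m) := fun _ _ h => by injection h
  set w₁ := clEval (notOps AddW.b) w with hw₁
  have hw₁v : ∀ x, w₁ x = if x ∈ Set.range AddW.b then !w x else w x := fun x => clEval_notOps AddW.b hinj w x
  have hs₁ : ∀ j, w₁ (AddW.s j) = false := fun j => by rw [hw₁v, if_neg (by rintro ⟨_, h⟩; injection h)]; exact hs j
  have hc₁ : ∀ j : Fin (m + 1), j ≠ 0 → w₁ (AddW.c j) = false := fun j _ => by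
    rw [hw₁v, if_neg (by rintro ⟨_, h⟩; injection h)]; exact hc j
  have hc₁0 : w₁ (AddW.c 0) = false := by rw [hw₁v, if_neg (by rintro ⟨_, h⟩; injection h)]; exact hc 0
  have ha₁ : ∀ j, w₁ (AddW.a j) = w (AddW.a j) := fun j => by rw [hw₁v, if_neg (by rintro ⟨_, h⟩; injection h)]
  have hb₁ : ∀ j, w₁ (AddW.b j) = !w (AddW.b j) := fun j => by rw [hw₁v, if_pos ⟨j, rfl⟩]
  set w₂ := clEval (addOps m) w₁ with hw₂
  have hw₂v := clEval_addOps w₁ hs₁ hc₁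
  have key : ∀ x, clEval (ltOps m) w x = if x ∈ Set.range AddW.b then !w₂ x else w₂ x := by
    intro x; rw [ltOps, clEval_append, clEval_append, ← hw₁, ← hw₂, clEval_notOps AddW.b hinj]
  refine ⟨?_, fun j => ?_, fun j => ?_⟩
  · rw [key, if_neg (by rintro ⟨_, h⟩; injection h), hw₂, hw₂v]
    simp only
    -- numerics: `val(s) + c_m 2^m = val(a) + (2^m - 1 - val(b))`
    have hsum := regVal_addOps w₁ hs₁ hc₁
    rw [hc₁0, Bool.toNat_false, add_zero, clEval_addOps w₁ hs₁ hc₁] at hsum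
    simp only at hsum
    have hnot := regVal_not AddW.b w w₁ hb₁
    have hA : regVal AddW.a w₁ = regVal AddW.a w := regVal_congr ha₁
    rw [hA] at hsum
    have hslt := regVal_lt AddW.s (clEval (addOps m) w₁)
    have hBlt := regVal_lt AddW.b w
    have hB₁lt := regVal_lt AddW.b w₁
    rcases Bool.eq_false_or_eq_true (AddW.carry w₁ ↑(Fin.last m)) with hcm | hcm <;> rw [hcm] at hsum ⊢
    · simp only [Bool.toNat_true, one_mul] at hsum
      symm; rw [decide_eq_true_iff]; omega
    · simp only [Bool.toNat_false, zero_mul, add_zero] at hsum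
      symm; rw [decide_eq_false_iff_not]; omega
  · rw [key, if_neg (by rintro ⟨_, h⟩; injection h), hw₂, hw₂v]; exact ha₁ j
  · rw [key, if_pos ⟨j, rfl⟩, hw₂, hw₂v]; simp only; rw [hb₁]; simp

end Compare

end Literature.Computability.QuantumComplexity
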